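import Literature.MathematicalPhysics.QuantumFieldTheory.Balaban1983to89.Node00.TorusCoverCubeMember
import Literature.MathematicalPhysics.QuantumFieldTheory.Balaban1983to89.Node00.TorusCoverGaugeLift
import Literature.MathematicalPhysics.QuantumFieldTheory.Balaban1983to89.Node00.LocalGaugeCoDivergenceLetters

/-!
# NODE 00 — TORUS COVER BOOKKEEPING FOR [15] SECT. F's «Δ₀ an arbitrary unit cube containing p or b»: every plaquette of `T_η` lies INSIDE (`plaqInside`), and every bond's
# (1.2)-stencil lies DEEP INSIDE (`Sect2.bondsDeep`), the image of the [6]-Prop.-6 DATUM BOX `box L (M·a) (M + 11d + L) n` of ONE grid cube — the box of the grid cube of the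
# plaquette's base corner, resp. of the bond's base corner minus `𝟙` — by index arithmetic alone (the box has upper slack `(11d + L)·Lⁿ ≥ 13` sites beyond the grid cube)

Cell `pub-ymgap`, width seat `pub-ymgap-dag-n07-w4` (director-ym №197 ∕ HUMAN RULING D-0149), node N07 = [15] = [Balaban1985Variational]; [6] = [Balaban1985RegularSpaces]; the
S3 → S6 junction of plan's `W-SEAT-START-LIST.md` § n07 (this seat's LOCATED-COVER-1 on the cell bus, 2026-08-28).  NEW leaf, PROOF kind (no `def`); CONSUMED BY NAME, nothing
modified: `B15Eq112TorusCover.(cover, lift, cover_lift)`, n07-e FILE 26 `Node00.TorusCoverCubeMember` (`propCube`, `propCube_a ∕ _M`), `Node00.TorusCoverGaugeLift`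
(`cover_add_e`, `cover_sub_e`), def-K0's `plaqInside`, 33b's `Sect2.bondsDeep`, `B14DomainGeom.(cubeIdx, cubeIdx_le, lt_cubeIdx)`, `B8Eq131Cubes.box`, `B14.Eq213MaximalDomains.side`.

WHY.  Print runs Sect. F around «a unit cube Δ₀ ⊂ B_j(Λ_j) containing p or b» (p. 302) — ANY unit cube containing the plaquette ∕ bond.  The tree's (152)∕(153) cube tokens
(n07-e FILE 29 ∕ 34c `Gauge152OfClassTopStepR(10)`, n07-w3 `gauge152_153_of_prop6`) conclude `Sect2.LocalGauge10On (cubeEnl S a 0) …` on the GRID cube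
`cubeEnl S a 0 = π(cubeExt S a 0)`, and the grid cubes PARTITION the torus: a plaquette straddling a grid face (`x_μ ≡ S − 1 (mod S)`) lies in no `plaqInside (cubeEnl S a′ 0)`, a
bond near a face has its stencil in no `bondsDeep (cubeEnl S a′ 0)`.  The S6 interface (`…N07HalvingStepTopOfLocalLetters.LocalLetters167∕165TopStep(Core)`: per plaquette
`∃ Y ∋ p`, per bond `b` deep in `Y`) therefore needs conclusions on sets WITH SLACK.  The [6] Prop.-6 datum of a grid cube (FILE 26 `propCube P n hn M a`: corner `M·a` blocks,
side `M′ = M + 11d + L` blocks at depth `n`) has the box `[LⁿM·aᵢ, Lⁿ(M·aᵢ + M′) − 1]ᵈ ⊇` the grid cube `[S·aᵢ, S·aᵢ + S − 1]ᵈ`, `S = LⁿM`, with UPPER slack `(11d + L)Lⁿ` — and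
(1.136)'s letters hold on the datum's cubes before 34b restricts them to the grid cube.  THIS FILE is the cover arithmetic that makes «conclude on `π(box)`» a COMPLETE cover:
`p ∈ plaqInside (π box(a(p)))` with `a(p) = cubeIdx S (lift p.src)`, and `b`'s stencil `⊂ π box(a(b))` with `a(b) = cubeIdx S (lift b.src − 𝟙)`.

CONTENTS.  §1 generic: `Sect2.mem_plaqInside_cover_inBox` (a box `[lo, hi]` on the cover containing `x` with `x + 𝟙 ≤ hi` contains the plaquettes based at `π x`),
`Sect2.mem_bondsDeep_cover_inBox` (`lo ≤ x − 𝟙`, `x + 2·𝟙 ≤ hi` ⇒ the bonds based at `π x` are deep).  §2 at the datum box: `Sect2.box_propCube_eq` (the box in grid units),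
★ `Sect2.mem_plaqInside_cover_box_propCube`, ★ `Sect2.mem_bondsDeep_cover_box_propCube`.  §3 the three WINDOW FACTS of a box `[lo, hi]` on the cover — n07-e 36b's hypotheses
`hinj` ∕ `hfwd` ∕ `hbwd` of `exists_localGauge10_window_of_gaugedBoundB8` at `X := box` (their ANSWER to LOCATED-COVER-1): `Sect2.eq_of_cover_eq_of_inBox` (width `≤` period),
`Sect2.add_e_mem_inBox_of_shift_mem_image`, `Sect2.sub_e_mem_inBox_of_unshift_mem_image` (width `<` period) — FILE 28b's ∕ 34b's `cubeExt` facts re-proved for an arbitrary box.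
§4 their instances at a block box `box L a M n` (width `LⁿM`; ANY datum's `□`): `Sect2.eq_of_cover_eq_of_mem_box`, `Sect2.add_e_mem_box_of_shift_mem_image`,
`Sect2.sub_e_mem_box_of_unshift_mem_image`, and at the datum box of a grid cube (width `Lⁿ(M + 11d + L)`): `Sect2.eq_of_cover_eq_of_mem_box_propCube`,
`Sect2.add_e_mem_box_propCube_of_shift_mem_image`, `Sect2.sub_e_mem_box_propCube_of_unshift_mem_image`.

HONEST FRAMING: index arithmetic on `ℤᵈ` and the torus cover; nothing of Bałaban asserted; no token re-declared or modified (the box-conclusion edition of the (152)∕(153) tokens is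
their declarers' call); N07 NOT discharged; K0⁷ ∕ K1⁷ NOT closed; counts unmoved (28∕28 · 5∕27); one finite 𝕋⁴ programme at fixed ε — R4 closes the conditional rung
`BalabanLadder.UV` only: NOT continuum ∕ ℝ⁴ ∕ OS ∕ mass gap ∕ Clay.  Theorems only; no `def`, `instance`, `notation`, `sorry`.
-/

noncomputable section

namespace Literature.MathematicalPhysics.QuantumFieldTheory.Balaban1983to89.Node00

open B15Eq112TorusCover (cover lift cover_lift)
open B14DomainGeom (Pt cubeIdx cubeIdx_le lt_cubeIdx)
open B14.Eq213MaximalDomains (side)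
open B7Prop1Explicit (e e_apply)
open B7Prop1Local (InBox)
open B8Eq131Cubes (box bLo bHi)

variable {P : Params}

/-! ## §1  A box on the cover with slack contains the plaquettes ∕ bond stencils based at its points -/

section Generic

/-- Coordinates of `x + e_μ`. [folklore] -/
private theorem add_e_apply (x : Pt P.d) (μ i : Fin P.d) : (x + e μ) i = x i + if i = μ then 1 else 0 := by
  simp [e_apply]

/-- Coordinates of `x − e_μ`. [folklore] -/
private theorem sub_e_apply (x : Pt P.d) (μ i : Fin P.d) : (x - e μ) i = x i - if i = μ then 1 else 0 := by
  simp [e_apply]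

/-- A cover point within `[lo, hi]` after a shift by a vector with entries in `{−1, 0, 1, 2}`-range bounds: if `lo ≤ x − 𝟙` … — elementary helper: `y` with
`x i - 1 ≤ y i ≤ x i + 2` for all `i` lies in `[lo, hi]` when `lo ≤ x − 𝟙` and `x + 2·𝟙 ≤ hi`. [folklore] -/
private theorem inBox_of_near {lo hi x y : Pt P.d} (hlo : ∀ i, lo i ≤ x i - 1) (hhi : ∀ i, x i + 2 ≤ hi i)
    (hy : ∀ i, x i - 1 ≤ y i ∧ y i ≤ x i + 2) : InBox lo hi y :=
  fun i => ⟨(hlo i).trans (hy i).1, (hy i).2.trans (hhi i)⟩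

/-- **PLAQUETTES**: if `x ∈ [lo, hi]` and `x + 𝟙 ≤ hi` (one site of upper slack), every plaquette based at `π x` lies INSIDE `π [lo, hi]` (all four corners; the corners are
`π(x)`, `π(x + e_μ)`, `π(x + e_ν)`, `π(x + e_μ + e_ν)` by `cover_add_e`). [cite: Balaban1985Variational, p.302 («a unit cube Δ₀ … containing p»); Balaban1988Convergent, (2.17) p.257 (bookkeeping)] -/
theorem Sect2.mem_plaqInside_cover_inBox {lo hi x : Pt P.d} (hx : InBox lo hi x) (hs : ∀ i, x i + 1 ≤ hi i) (p : Plaq P 0)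
    (hp : p.src = cover P x) : p ∈ plaqInside (cover P '' {z | InBox lo hi z}) := by
  have h1 : ∀ μ : Fin P.d, InBox lo hi (x + e μ) := fun μ i => by
    rw [add_e_apply]; split_ifs <;> constructor <;> linarith [(hx i).1, (hx i).2, hs i]
  have h2 : ∀ μ ν : Fin P.d, μ ≠ ν → InBox lo hi (x + e μ + e ν) := fun μ ν hμν i => by
    rw [add_e_apply, add_e_apply]
    by_cases hiμ : i = μ
    · subst hiμ; simp only [if_true, if_neg hμν]; constructor <;> linarith [(hx i).1, hs i]
    · simp only [if_neg hiμ]; split_ifs <;> constructor <;> linarith [(hx i).1, (hx i).2, hs i]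
  have hne : p.μ ≠ p.ν := ne_of_lt p.hμν
  refine ⟨⟨x, hx, hp.symm⟩, ⟨x + e p.μ, h1 _, ?_⟩, ⟨x + e p.ν, h1 _, ?_⟩, ⟨x + e p.μ + e p.ν, h2 _ _ hne, ?_⟩⟩
  · rw [cover_add_e, hp]
  · rw [cover_add_e, hp]
  · rw [cover_add_e, cover_add_e, hp]

/-- **BOND STENCILS**: if `lo ≤ x − 𝟙` and `x + 2·𝟙 ≤ hi`, every bond based at `π x` is DEEP in `π [lo, hi]` — its endpoints `π x`, `π(x + e_μ)` and their neighbours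
`π(x ± e_ν)`, `π(x + e_μ ± e_ν)` (the (1.2)-stencil of the co-divergence) all lie in `π [lo, hi]`. [cite: Balaban1985RegularSpaces, (1.2) p.76, (1.9) p.77 (bookkeeping)] -/
theorem Sect2.mem_bondsDeep_cover_inBox {lo hi x : Pt P.d} (hlo : ∀ i, lo i ≤ x i - 1) (hhi : ∀ i, x i + 2 ≤ hi i) (b : PBond P 0)
    (hb : b.src = cover P x) : b ∈ Sect2.bondsDeep (cover P '' {z | InBox lo hi z}) := by
  -- every stencil point is `π` of an integer point within `[x − 𝟙, x + 2·𝟙]`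
  have near0 : ∀ i : Fin P.d, x i - 1 ≤ x i ∧ x i ≤ x i + 2 := fun i => ⟨by linarith, by linarith⟩
  have nearA : ∀ μ i : Fin P.d, x i - 1 ≤ (x + e μ) i ∧ (x + e μ) i ≤ x i + 2 := fun μ i => by
    rw [add_e_apply]; split_ifs <;> constructor <;> linarith
  have nearS : ∀ μ i : Fin P.d, x i - 1 ≤ (x - e μ) i ∧ (x - e μ) i ≤ x i + 2 := fun μ i => by
    rw [sub_e_apply]; split_ifs <;> constructor <;> linarith
  have nearAA : ∀ μ ν i : Fin P.d, x i - 1 ≤ (x + e μ + e ν) i ∧ (x + e μ + e ν) i ≤ x i + 2 := fun μ ν i => by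
    rw [add_e_apply, add_e_apply]; split_ifs <;> constructor <;> linarith
  have nearAS : ∀ μ ν i : Fin P.d, x i - 1 ≤ (x + e μ - e ν) i ∧ (x + e μ - e ν) i ≤ x i + 2 := fun μ ν i => by
    rw [sub_e_apply, add_e_apply]; split_ifs <;> constructor <;> linarith
  have mem : ∀ y : Pt P.d, (∀ i, x i - 1 ≤ y i ∧ y i ≤ x i + 2) → cover P y ∈ cover P '' {z | InBox lo hi z} :=
    fun y hy => ⟨y, inBox_of_near hlo hhi hy, rfl⟩
  have htgt : b.tgt = cover P (x + e b.dir) := by rw [PBond.tgt, hb, cover_add_e]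
  refine ⟨?_, ?_, fun ν => ⟨?_, ?_, ?_, ?_⟩⟩
  · rw [hb]; exact mem x near0
  · rw [htgt]; exact mem _ (nearA _)
  · rw [hb, ← cover_add_e]; exact mem _ (nearA _)
  · rw [hb, ← cover_sub_e]; exact mem _ (nearS _)
  · rw [htgt, ← cover_add_e]; exact mem _ (nearAA _ _)
  · rw [htgt, ← cover_sub_e]; exact mem _ (nearAS _ _)

end Generic

/-! ## §2  At the [6]-Prop.-6 datum box of the grid cube of the base corner -/

section DatumBox

/-- **THE DATUM BOX IN GRID UNITS**: for the Prop.-6 datum `propCube P n hn M a` of the grid cube of index `a` (corner `M·a` blocks, side `M + 11d + L` blocks, depth `n`),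
`box L (M·a) (M + 11d + L) n = {z | ∀ i, S·aᵢ ≤ zᵢ ∧ zᵢ ≤ S·aᵢ + S + (11d + L)·Lⁿ − 1}` with `S = side L M n = LⁿM` — the grid cube `[S·aᵢ, S·aᵢ + S − 1]` plus the upper
slack `(11d + L)·Lⁿ`. [cite: Balaban1985RegularSpaces, p.98 («we take a size of □ equal to MLʲη»); Balaban1985Variational, (144) p.300 (bookkeeping)] -/
theorem Sect2.mem_box_propCube_iff {n : ℕ} (hn : 1 ≤ n) (M : ℕ) (a z : Pt P.d) :
    z ∈ box P.L (propCube P n hn M a).a (propCube P n hn M a).M n ↔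
      ∀ i, ((side P.L M n : ℕ) : ℤ) * a i ≤ z i ∧ z i ≤ ((side P.L M n : ℕ) : ℤ) * a i + (side P.L M n : ℕ) + (11 * P.d + P.L) * (P.L : ℤ) ^ n - 1 := by
  simp only [box, Set.mem_setOf_eq, InBox, bLo, bHi, propCube_a, propCube_M, side]
  push_cast
  refine forall_congr' fun i => ?_
  constructor
  · rintro ⟨h1, h2⟩; constructor <;> nlinarith [h1, h2]
  · rintro ⟨h1, h2⟩; constructor <;> nlinarith [h1, h2]

/-- `(11d + L)·Lⁿ ≥ 3`: the datum box's upper slack is at least three sites (`d ≥ 1`, `L ≥ 2`). [cite: Balaban1985RegularSpaces, (1.130) p.99 (bookkeeping)] -/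
private theorem three_le_slack (P : Params) (n : ℕ) : (3 : ℤ) ≤ (11 * P.d + P.L) * (P.L : ℤ) ^ n := by
  have hd : (1 : ℤ) ≤ P.d := by exact_mod_cast P.hd
  have hL : (2 : ℤ) ≤ P.L := by exact_mod_cast P.hL.2
  have hLn : (1 : ℤ) ≤ (P.L : ℤ) ^ n := one_le_pow₀ (by linarith)
  nlinarith

/-- ★ **EVERY PLAQUETTE LIES INSIDE THE IMAGE OF THE DATUM BOX OF THE GRID CUBE OF ITS BASE CORNER**: for `p : Plaq (T_η)`, `n ≥ 1`, `M ≥ 1`, with `S = side L M n` and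
`a := cubeIdx S (lift p.src)`: `p ∈ plaqInside (π (box L (M·a) (M + 11d + L) n))` — the base corner's lift `x` has `S·aᵢ ≤ xᵢ ≤ S·aᵢ + S − 1`, the other three corners exceed
it by at most `1 ≤ (11d + L)Lⁿ` (the slack).  So a token concluding `Sect2.LocalGauge10On (π box) …` on every grid cube's datum box serves EVERY plaquette of the S6 interface.
[cite: Balaban1985Variational, p.302 («a unit cube Δ₀ ⊂ B_j(Λ_j) containing p or b»), (144) p.300; Balaban1985RegularSpaces, p.98] -/
theorem Sect2.mem_plaqInside_cover_box_propCube (p : Plaq P 0) {n : ℕ} (hn : 1 ≤ n) {M : ℕ} (hM : 1 ≤ M) :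
    p ∈ plaqInside (cover P '' box P.L (propCube P n hn M (cubeIdx (side P.L M n) (lift P p.src))).a
      (propCube P n hn M (cubeIdx (side P.L M n) (lift P p.src))).M n) := by
  set S := side P.L M n with hS
  set x := lift P p.src with hx
  set a := cubeIdx S x with ha
  have hSpos : 0 < S := B14.Eq213MaximalDomains.side_pos P.L_pos hM n
  have hslack := three_le_slack P n
  have hbox : box P.L (propCube P n hn M a).a (propCube P n hn M a).M n =
      {z | InBox (fun i => (S : ℤ) * a i) (fun i => (S : ℤ) * a i + S + (11 * P.d + P.L) * (P.L : ℤ) ^ n - 1) z} := by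
    ext z; rw [Sect2.mem_box_propCube_iff]; rfl
  rw [hbox]
  refine Sect2.mem_plaqInside_cover_inBox (x := x) (fun i => ⟨cubeIdx_le S hSpos x i, ?_⟩) (fun i => ?_) p (by rw [hx, cover_lift])
  · have := lt_cubeIdx S hSpos x i; linarith
  · have := lt_cubeIdx S hSpos x i; linarith

/-- ★ **EVERY BOND's (1.2)-STENCIL LIES DEEP INSIDE THE IMAGE OF THE DATUM BOX OF THE GRID CUBE OF ITS BASE CORNER MINUS `𝟙`**: for `b : PBond (T_η)`, `n ≥ 1`, `M ≥ 1`,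
`S = side L M n`, `a := cubeIdx S (lift b.src − 𝟙)`: `b ∈ Sect2.bondsDeep (π (box L (M·a) (M + 11d + L) n))` — with `x = lift b.src`, `S·aᵢ ≤ xᵢ − 1` and
`xᵢ + 2 ≤ S·aᵢ + S + 2 ≤` the box's top (slack `≥ 3`), while the stencil lies in `[x − 𝟙, x + 2·𝟙]`.
[cite: Balaban1985RegularSpaces, (1.2) p.76, (1.9) p.77, p.98; Balaban1985Variational, p.302, (144) p.300] -/
theorem Sect2.mem_bondsDeep_cover_box_propCube (b : PBond P 0) {n : ℕ} (hn : 1 ≤ n) {M : ℕ} (hM : 1 ≤ M) :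
    b ∈ Sect2.bondsDeep (cover P '' box P.L (propCube P n hn M (cubeIdx (side P.L M n) (lift P b.src - fun _ => 1))).a
      (propCube P n hn M (cubeIdx (side P.L M n) (lift P b.src - fun _ => 1))).M n) := by
  set S := side P.L M n with hS
  set x := lift P b.src with hx
  set a := cubeIdx S (x - fun _ => 1) with ha
  have hSpos : 0 < S := B14.Eq213MaximalDomains.side_pos P.L_pos hM n
  have hslack := three_le_slack P n
  have hbox : box P.L (propCube P n hn M a).a (propCube P n hn M a).M n =
      {z | InBox (fun i => (S : ℤ) * a i) (fun i => (S : ℤ) * a i + S + (11 * P.d + P.L) * (P.L : ℤ) ^ n - 1) z} := by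
    ext z; rw [Sect2.mem_box_propCube_iff]; rfl
  rw [hbox]
  refine Sect2.mem_bondsDeep_cover_inBox (x := x) (fun i => ?_) (fun i => ?_) b (by rw [hx, cover_lift])
  · have h := cubeIdx_le S hSpos (x - fun _ => 1) i
    simp only [Pi.sub_apply] at h
    exact h
  · have h := lt_cubeIdx S hSpos (x - fun _ => 1) i
    simp only [Pi.sub_apply] at h
    linarith

end DatumBox

/-! ## §3  The three WINDOW FACTS of a non-wrapping box `[lo, hi]` on the cover (n07-e 36b's `hinj` ∕ `hfwd` ∕ `hbwd` at `X := box`) -/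

section Window

/-- **THE COVER IS INJECTIVE ON A BOX OF WIDTH AT MOST THE PERIOD** (`hi − lo + 1 ≤ 2L^{m+K}` coordinatewise): two points of `[lo, hi]` with the same image coincide —
FILE 28b's `eq_of_cover_eq_of_mem_cubeExt` for an arbitrary box. [cite: Balaban1987RG1, (0.1) p.251 (the torus by identification of boundary points)] -/
theorem Sect2.eq_of_cover_eq_of_inBox {lo hi : Pt P.d} (hw : ∀ i, hi i - lo i + 1 ≤ P.sitesPerDir 0) {x x' : Pt P.d} (hx : InBox lo hi x)
    (hx' : InBox lo hi x') (h : cover P x = cover P x') : x = x' := by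
  obtain ⟨v, hv⟩ := (B15Eq112TorusCover.cover_eq_cover_iff x x').1 h
  rw [hv]
  have hv0 : v = 0 := by
    funext i
    have h1 := hx i
    have h2 := hx' i
    have hwi := hw i
    rw [hv] at h2
    simp only [Pi.add_apply, B15LatticeCubeTorus.pmul, B15Eq112TorusCover.per_apply] at h2
    have hn : (0 : ℤ) < (P.sitesPerDir 0 : ℤ) := by exact_mod_cast Nat.pos_of_ne_zero (P.sitesPerDir_ne_zero 0)
    rcases lt_trichotomy (v i) 0 with hlt | heq | hgt
    · have : (P.sitesPerDir 0 : ℤ) * v i ≤ (P.sitesPerDir 0 : ℤ) * (-1) := mul_le_mul_of_nonneg_left (by omega) hn.le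
      omega
    · exact heq
    · have : (P.sitesPerDir 0 : ℤ) * 1 ≤ (P.sitesPerDir 0 : ℤ) * v i := mul_le_mul_of_nonneg_left (by omega) hn.le
      omega
  simp [hv0]

/-- **FORWARD UNIT STEPS SEEN ON THE TORUS LIFT INTO THE BOX** (width `<` period): `x ∈ [lo, hi]` and `π x + e_μ ∈ π [lo, hi]` give `x + e_μ ∈ [lo, hi]` — FILE 28b's
`add_e_mem_cubeExt_of_shift_mem_image` for an arbitrary box. [cite: Balaban1987RG1, (0.1) p.251 (bookkeeping on the torus)] -/
theorem Sect2.add_e_mem_inBox_of_shift_mem_image {lo hi : Pt P.d} (hw : ∀ i, hi i - lo i + 1 < P.sitesPerDir 0) {x : Pt P.d} (hx : InBox lo hi x)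
    {μ : Fin P.d} (h : (cover P x).shift μ ∈ cover P '' {z | InBox lo hi z}) : InBox lo hi (x + e μ) := by
  obtain ⟨x', hx', hc⟩ := h
  rw [← cover_add_e] at hc
  obtain ⟨v, hv⟩ := (B15Eq112TorusCover.cover_eq_cover_iff x' (x + e μ)).1 hc
  have hv0 : v = 0 := by
    funext i
    have h1 := hx i
    have h2 : lo i ≤ x' i ∧ x' i ≤ hi i := hx' i
    have h3 := congrFun hv i
    have hwi := hw i
    simp only [Pi.add_apply, B15LatticeCubeTorus.pmul, B15Eq112TorusCover.per_apply, e_apply] at h3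
    have hn : (0 : ℤ) < (P.sitesPerDir 0 : ℤ) := by exact_mod_cast Nat.pos_of_ne_zero (P.sitesPerDir_ne_zero 0)
    rcases lt_trichotomy (v i) 0 with hlt | heq | hgt
    · have : (P.sitesPerDir 0 : ℤ) * v i ≤ (P.sitesPerDir 0 : ℤ) * (-1) := mul_le_mul_of_nonneg_left (by omega) hn.le
      split_ifs at h3 <;> omega
    · exact heq
    · have : (P.sitesPerDir 0 : ℤ) * 1 ≤ (P.sitesPerDir 0 : ℤ) * v i := mul_le_mul_of_nonneg_left (by omega) hn.le
      split_ifs at h3 <;> omega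
  have : x + e μ = x' := by rw [hv, hv0]; simp
  rw [this]; exact hx'

/-- **BACKWARD UNIT STEPS SEEN ON THE TORUS LIFT INTO THE BOX** (width `<` period): `x ∈ [lo, hi]` and `π x − e_ν ∈ π [lo, hi]` give `x − e_ν ∈ [lo, hi]` — 34b's
`sub_e_mem_cubeExt_of_unshift_mem_image` for an arbitrary box. [cite: Balaban1987RG1, (0.1) p.251 (bookkeeping on the torus)] -/
theorem Sect2.sub_e_mem_inBox_of_unshift_mem_image {lo hi : Pt P.d} (hw : ∀ i, hi i - lo i + 1 < P.sitesPerDir 0) {x : Pt P.d} (hx : InBox lo hi x)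
    {ν : Fin P.d} (h : (cover P x).unshift ν ∈ cover P '' {z | InBox lo hi z}) : InBox lo hi (x - e ν) := by
  obtain ⟨z, hz, hcz⟩ := h
  have hz0 : InBox lo hi z := hz
  have hzx : (cover P z).shift ν ∈ cover P '' {z | InBox lo hi z} := by
    rw [hcz, ← cover_sub_e, ← cover_add_e, sub_add_cancel]; exact ⟨x, hx, rfl⟩
  have hz' : InBox lo hi (z + e ν) := Sect2.add_e_mem_inBox_of_shift_mem_image hw hz0 hzx
  have hcov : cover P (z + e ν) = cover P x := by rw [cover_add_e, hcz, ← cover_sub_e, ← cover_add_e, sub_add_cancel]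
  have := Sect2.eq_of_cover_eq_of_inBox (fun i => (hw i).le) hz' hx hcov
  rw [← this, add_sub_cancel_right]; exact hz0

end Window

/-! ## §4  The window facts at a block box `box L a M n = [Lⁿaᵢ, Lⁿ(aᵢ + M) − 1]ᵈ` (any [6]-Prop.-6 datum's `□`) and at the datum box of a grid cube -/

section DatumWindow

/-- The width of a block box in sites: `hi − lo + 1 = Lⁿ·M` coordinatewise. [cite: Balaban1985RegularSpaces, p.98 (bookkeeping)] -/
private theorem width_box (a : Pt P.d) (M n : ℕ) (i : Fin P.d) :
    bHi P.L a M n 0 i - bLo P.L a n 0 i + 1 = ((P.L ^ n * M : ℕ) : ℤ) := by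
  simp only [bLo, bHi]
  push_cast
  ring

/-- **THE COVER IS INJECTIVE ON A BLOCK BOX** `box L a M n` (the `□` of ANY [6]-Prop.-6 datum `c`: `a = c.a`, `M = c.M`, `n = c.k`) when it does not wrap: `Lⁿ·M ≤ 2L^{m+K}` —
n07-e 36b's `hinj` at `X := box`. [cite: Balaban1987RG1, (0.1) p.251; Balaban1985RegularSpaces, p.98] -/
theorem Sect2.eq_of_cover_eq_of_mem_box {a : Pt P.d} {M n : ℕ} (hW : ((P.L ^ n * M : ℕ) : ℤ) ≤ P.sitesPerDir 0) {x x' : Pt P.d}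
    (hx : x ∈ box P.L a M n) (hx' : x' ∈ box P.L a M n) (h : cover P x = cover P x') : x = x' :=
  Sect2.eq_of_cover_eq_of_inBox (fun i => by rw [width_box a M n i]; exact hW) hx hx' h

/-- **FORWARD UNIT STEPS LIFT INTO A BLOCK BOX** when it does not wrap strictly (`Lⁿ·M < 2L^{m+K}`) — 36b's `hfwd` at `X := box`.
[cite: Balaban1987RG1, (0.1) p.251; Balaban1985RegularSpaces, p.98] -/
theorem Sect2.add_e_mem_box_of_shift_mem_image {a : Pt P.d} {M n : ℕ} (hW : ((P.L ^ n * M : ℕ) : ℤ) < P.sitesPerDir 0) {x : Pt P.d}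
    (hx : x ∈ box P.L a M n) {μ : Fin P.d} (h : (cover P x).shift μ ∈ cover P '' box P.L a M n) : x + e μ ∈ box P.L a M n :=
  Sect2.add_e_mem_inBox_of_shift_mem_image (fun i => by rw [width_box a M n i]; exact hW) hx h

/-- **BACKWARD UNIT STEPS LIFT INTO A BLOCK BOX** when it does not wrap strictly — 36b's `hbwd` at `X := box`. [cite: Balaban1987RG1, (0.1) p.251; Balaban1985RegularSpaces, p.98] -/
theorem Sect2.sub_e_mem_box_of_unshift_mem_image {a : Pt P.d} {M n : ℕ} (hW : ((P.L ^ n * M : ℕ) : ℤ) < P.sitesPerDir 0) {x : Pt P.d}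
    (hx : x ∈ box P.L a M n) {ν : Fin P.d} (h : (cover P x).unshift ν ∈ cover P '' box P.L a M n) : x - e ν ∈ box P.L a M n :=
  Sect2.sub_e_mem_inBox_of_unshift_mem_image (fun i => by rw [width_box a M n i]; exact hW) hx h

/-- **THE DATUM BOX OF A GRID CUBE DOES NOT WRAP iff `Lⁿ(M + 11d + L) ≤ ∕ < 2L^{m+K}`**: its block side is `propCube_M = M + 11d + L`; the three window facts at
`propCube P n hn M a` — injectivity. [cite: Balaban1987RG1, (0.1) p.251; Balaban1985RegularSpaces, p.98, (1.130) p.99] -/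
theorem Sect2.eq_of_cover_eq_of_mem_box_propCube {n : ℕ} (hn : 1 ≤ n) {M : ℕ} (a : Pt P.d)
    (hW : ((P.L ^ n * (M + 11 * P.d + P.L) : ℕ) : ℤ) ≤ P.sitesPerDir 0) {x x' : Pt P.d}
    (hx : x ∈ box P.L (propCube P n hn M a).a (propCube P n hn M a).M n) (hx' : x' ∈ box P.L (propCube P n hn M a).a (propCube P n hn M a).M n)
    (h : cover P x = cover P x') : x = x' :=
  Sect2.eq_of_cover_eq_of_mem_box (by rw [propCube_M]; exact hW) hx hx' h

/-- The forward-step window fact at the datum box of a grid cube. [cite: Balaban1987RG1, (0.1) p.251; Balaban1985RegularSpaces, p.98] -/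
theorem Sect2.add_e_mem_box_propCube_of_shift_mem_image {n : ℕ} (hn : 1 ≤ n) {M : ℕ} (a : Pt P.d)
    (hW : ((P.L ^ n * (M + 11 * P.d + P.L) : ℕ) : ℤ) < P.sitesPerDir 0) {x : Pt P.d}
    (hx : x ∈ box P.L (propCube P n hn M a).a (propCube P n hn M a).M n) {μ : Fin P.d}
    (h : (cover P x).shift μ ∈ cover P '' box P.L (propCube P n hn M a).a (propCube P n hn M a).M n) :
    x + e μ ∈ box P.L (propCube P n hn M a).a (propCube P n hn M a).M n :=
  Sect2.add_e_mem_box_of_shift_mem_image (by rw [propCube_M]; exact hW) hx h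

/-- The backward-step window fact at the datum box of a grid cube. [cite: Balaban1987RG1, (0.1) p.251; Balaban1985RegularSpaces, p.98] -/
theorem Sect2.sub_e_mem_box_propCube_of_unshift_mem_image {n : ℕ} (hn : 1 ≤ n) {M : ℕ} (a : Pt P.d)
    (hW : ((P.L ^ n * (M + 11 * P.d + P.L) : ℕ) : ℤ) < P.sitesPerDir 0) {x : Pt P.d}
    (hx : x ∈ box P.L (propCube P n hn M a).a (propCube P n hn M a).M n) {ν : Fin P.d}
    (h : (cover P x).unshift ν ∈ cover P '' box P.L (propCube P n hn M a).a (propCube P n hn M a).M n) :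
    x - e ν ∈ box P.L (propCube P n hn M a).a (propCube P n hn M a).M n :=
  Sect2.sub_e_mem_box_of_unshift_mem_image (by rw [propCube_M]; exact hW) hx h

end DatumWindow

end Literature.MathematicalPhysics.QuantumFieldTheory.Balaban1983to89.Node00

end
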